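import Summits.HodgeConjecture.HodgeConjecture.Theses.GenericDivisibility

/-!
# `GenericDivisibilityBounded` (C2, stmt-HodgeConjecture-18467) · Negative · load-bearing hypotheses

Negative knowledge for the crux `GenericDivisibility.GenericDivisibilityBounded` (route
GenericDivisibility, rank 3), extracted from the standing disprover's work file
`Cruxes/GenericDivisibilityBounded/Disproof.lean` (cdisprove cycle 1, 2026-08-17; its module docblock
carries the paper analysis: C2(X) ⟺ `I ∩ div(H^{2p}_nr(X;ℤ)) = 0` with `I = H^{2p}(X;ℤ)/N¹` f.g. free,
true for `p = 1`, first open case `p = 2` ⟸ no aligned `ℚ/ℤ` in `H²(X,𝓗³(ℤ))`).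

* `∀ m` IS LOAD-BEARING (`genericDivisibilityBounded_false_without_allModuli`): for every single
  modulus `m ≥ 1` the one-modulus variant `GenericDivisibilityBoundedSingleModulus m` is false as soon
  as ONE smooth projective `2p`-fold carries an integral middle class of coniveau `0`
  (`ExistsMiddleClassOfConiveauZero`; true in print — Grothendieck 1969 —, not yet constructed on the
  tree's carriers): `z = m • z₀` is `m`-divisible on all of `X(ℂ)`.
* THE DECL IS THE WEAK (all-moduli) FORM: `not_primePower_of_not` — a refutation of C2 as filed is a
  class divisible by EVERY integer on opens; an `ℓ`-adic phantom (one prime) only kills the stronger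
  `GenericDivisibilityBoundedPrimePower` of the route's kill criterion.
* NO JUNK OPEN: `genericDivisibilityBounded_iff_codimOne` — inside `IsSmoothProjective` (geometrically
  irreducible) "closed `Z ≠ univ`" is exactly "closed, all points of codimension `≥ 1`", the indexing
  of `supportedClasses … 1`.
* TORSION WITNESSES ARE INERT (`conclusion_of_torsion`, `hypothesis_of_torsion`): an `N`-torsion class
  has complexification `0 ∈ N¹`, and — granted the route's support item `TorsionDiesGenerically` —
  also satisfies the hypothesis; Atiyah–Hirzebruch / Kollár-type classes cannot refute C2.
Refuter seat refuter-cdisprove-stmt-HodgeConjecture-18467-0 (cdisprove cycle 1), 2026-08-17.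
-/

noncomputable section

-- The mandated namespace `Summit.<P>.<Sub>.Theorems.…` repeats `HodgeConjecture` (single-conjunct summit).
set_option linter.dupNamespace false

open CategoryTheory AlgebraicGeometry

namespace Summit.HodgeConjecture.HodgeConjecture.Theorems.GenericDivisibilityBounded.Negative.LoadBearing

open Literature.AlgebraicGeometry.Motives Literature.AlgebraicGeometry.HodgeTheory
  Literature.AlgebraicTopology.SingularHomology
open Summit.HodgeConjecture.HodgeConjecture.Theses.GenericDivisibility
  (GenericDivisibilityBounded TorsionDiesGenerically)

/-! ### Vocabulary -/

/-- Restriction `z ↦ z|_{(X ∖ Z)(ℂ)}` in integral cohomology (the map written inline in the decl). -/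
abbrev restrictOff (X : SchemeOver ℂ) (Z : Set X.left) (k : ℕ)
    (z : singularCohomology ℤ ℤ (ComplexPoints X) k) :
    singularCohomology ℤ ℤ (complexPointsCompl X Z) k :=
  singularCohomology.map ℤ ℤ
    (⟨Subtype.val, continuous_subtype_val⟩ : C(complexPointsCompl X Z, ComplexPoints X)) k z

/-- `z` is divisible by `m` on SOME non-empty Zariski open: the inner hypothesis of C2 at one `m`. -/
def GenericallyDivisible (X : SchemeOver ℂ) (k m : ℕ)
    (z : singularCohomology ℤ ℤ (ComplexPoints X) k) : Prop :=
  ∃ Z : Set X.left, IsClosed Z ∧ Z ≠ Set.univ ∧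
    ∃ y : singularCohomology ℤ ℤ (complexPointsCompl X Z) k, m • y = restrictOff X Z k z

/-- The crux, restated through `GenericallyDivisible` (definitionally the filed decl). -/
theorem genericDivisibilityBounded_iff :
    GenericDivisibilityBounded ↔
      ∀ ⦃p : ℕ⦄ ⦃X : SchemeOver ℂ⦄, 1 ≤ p → IsSmoothProjective (2 * p) X →
        ∀ z : singularCohomology ℤ ℤ (ComplexPoints X) (2 * p),
          (∀ m : ℕ, 1 ≤ m → GenericallyDivisible X (2 * p) m z) →
            singularCohomology.ringChange (Int.castRingHom ℂ) (ComplexPoints X) (2 * p) z ∈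
              supportedClasses X (2 * p) 1 :=
  Iff.rfl

/-! ### (c) Torsion classes: the Atiyah–Hirzebruch / Kollár witnesses cannot bite C2 -/

section Torsion

variable {X : SchemeOver ℂ}

/-- A torsion integral class has zero complexification (`H(−;ℂ)` is a `ℂ`-vector space). -/
theorem ringChange_eq_zero_of_torsion {k N : ℕ} (hN : 1 ≤ N)
    (z : singularCohomology ℤ ℤ (ComplexPoints X) k) (hz : N • z = 0) :
    singularCohomology.ringChange (Int.castRingHom ℂ) (ComplexPoints X) k z = 0 := by
  have h := congrArg (singularCohomology.ringChange (Int.castRingHom ℂ) (ComplexPoints X) k) hz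
  rw [map_nsmul, map_zero, ← Nat.cast_smul_eq_nsmul ℂ, smul_eq_zero] at h
  exact h.resolve_left (by exact_mod_cast (show N ≠ 0 by omega))

/-- Hence a torsion class satisfies the CONCLUSION of C2 outright (no hypothesis on `X`). -/
theorem conclusion_of_torsion {k r N : ℕ} (hN : 1 ≤ N)
    (z : singularCohomology ℤ ℤ (ComplexPoints X) k) (hz : N • z = 0) :
    singularCohomology.ringChange (Int.castRingHom ℂ) (ComplexPoints X) k z ∈
      supportedClasses X k r := by
  rw [ringChange_eq_zero_of_torsion hN z hz]
  exact Submodule.zero_mem _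

/-- Restriction commutes with `ℕ`-multiples. -/
theorem restrictOff_nsmul (Z : Set X.left) (k m : ℕ)
    (z : singularCohomology ℤ ℤ (ComplexPoints X) k) :
    restrictOff X Z k (m • z) = m • restrictOff X Z k z :=
  map_nsmul _ _ _

/-- … and, granted the route's own support item `TorsionDiesGenerically` (CT–Voisin Thm 3.1, the
Bloch–Kato shadow), a torsion class also satisfies the HYPOTHESIS of C2 (it dies on a non-empty
open, where `0 = m • 0`). So torsion witnesses (Atiyah–Hirzebruch 1962, Kollár 1992 after scaling)
satisfy C2 trivially: the barrier evasion claimed by the route is correct for C2. -/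
theorem hypothesis_of_torsion (hT : TorsionDiesGenerically) {p : ℕ} (hp : 1 ≤ p)
    (hX : IsSmoothProjective (2 * p) X) (z : singularCohomology ℤ ℤ (ComplexPoints X) (2 * p))
    {N : ℕ} (hN : 1 ≤ N) (hz : N • z = 0) {m : ℕ} :
    GenericallyDivisible X (2 * p) m z := by
  haveI := hX.geometricallyIrreducible
  haveI : IrreducibleSpace X.left := GeometricallyIrreducible.irreducibleSpace_of_subsingleton X.hom
  have hw : N • restrictOff X ∅ (2 * p) z = 0 := by
    rw [← restrictOff_nsmul, hz]; exact map_zero _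
  obtain ⟨Z', h, hZ'c, hZ'ne, hzero⟩ :=
    hT hp hX ∅ isClosed_empty (Set.empty_ne_univ) (restrictOff X ∅ (2 * p) z) N hN hw
  refine ⟨Z', hZ'c, hZ'ne, 0, ?_⟩
  rw [smul_zero]
  -- `z|_{X∖Z'}` factors through `z|_{X∖∅}`
  have hfac : (⟨Subtype.val, continuous_subtype_val⟩ : C(complexPointsCompl X Z', ComplexPoints X)) =
      (⟨Subtype.val, continuous_subtype_val⟩ : C(complexPointsCompl X ∅, ComplexPoints X)).comp
        (⟨fun P : complexPointsCompl X Z' => (⟨P.1, fun hP : P.1.pt ∈ (∅ : Set X.left) => P.2 (h hP)⟩ :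
            complexPointsCompl X ∅),
          continuous_subtype_val.subtype_mk fun (P : complexPointsCompl X Z')
            (hP : P.1.pt ∈ (∅ : Set X.left)) => P.2 (h hP)⟩ :
          C(complexPointsCompl X Z', complexPointsCompl X ∅)) := rfl
  change 0 = singularCohomology.map ℤ ℤ _ (2 * p) z
  rw [hfac, singularCohomology.map_comp, ModuleCat.comp_apply]
  exact hzero.symm

end Torsion

/-! ### (a) `∀ m` is load-bearing -/

/-- C2 with divisibility by ONE modulus `m` only (the quantifier `∀ m` pulled out of the hypothesis). -/
def GenericDivisibilityBoundedSingleModulus (m : ℕ) : Prop :=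
  ∀ ⦃p : ℕ⦄ ⦃X : SchemeOver ℂ⦄, 1 ≤ p → IsSmoothProjective (2 * p) X →
    ∀ z : singularCohomology ℤ ℤ (ComplexPoints X) (2 * p),
      GenericallyDivisible X (2 * p) m z →
        singularCohomology.ringChange (Int.castRingHom ℂ) (ComplexPoints X) (2 * p) z ∈
          supportedClasses X (2 * p) 1

/-- `H_coniv0`: SOME smooth projective `2p`-fold (`p ≥ 1`) carries an integral middle class of
coniveau `0` (complexification outside `N¹`). True in print — any integral class meeting `H^{2p,0}`,
e.g. on an abelian surface (`N¹ ⊗ ℂ ⊆ F¹`, Grothendieck 1969 §1; Voisin I §11.3) — but NOT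
constructible in the tree today (no computed example of a class outside `N¹`; the Grothendieck-1969
barrier is itself vendored as a hypothesis). Reference: Grothendieck, Topology 8 (1969), §1. Deliberately
NOT tagged as a cited fact: it is the hypothesis `H` of a `_false_without_` lemma, local to this file. -/
def ExistsMiddleClassOfConiveauZero : Prop :=
  ∃ (p : ℕ) (X : SchemeOver ℂ) (z : singularCohomology ℤ ℤ (ComplexPoints X) (2 * p)),
    1 ≤ p ∧ IsSmoothProjective (2 * p) X ∧
      singularCohomology.ringChange (Int.castRingHom ℂ) (ComplexPoints X) (2 * p) z ∉
        supportedClasses X (2 * p) 1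

/-- **Any proof of C2 must use `∀ m`**: for every single modulus `m ≥ 1` the one-modulus variant
fails as soon as one middle class `z₀` of coniveau `0` exists — `z = m • z₀` is `m`-divisible on all
of `X(ℂ)` (`Z = ∅`) yet `z ⊗ 1 = m (z₀ ⊗ 1) ∉ N¹`. -/
theorem genericDivisibilityBounded_false_without_allModuli (hE : ExistsMiddleClassOfConiveauZero)
    {m : ℕ} (hm : 1 ≤ m) : ¬ GenericDivisibilityBoundedSingleModulus m := by
  obtain ⟨p, X, z₀, hp, hX, hz₀⟩ := hE
  intro h
  haveI := hX.geometricallyIrreducible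
  haveI : IrreducibleSpace X.left := GeometricallyIrreducible.irreducibleSpace_of_subsingleton X.hom
  have hdiv : GenericallyDivisible X (2 * p) m (m • z₀) :=
    ⟨∅, isClosed_empty, Set.empty_ne_univ, restrictOff X ∅ (2 * p) z₀,
      (restrictOff_nsmul ∅ (2 * p) m z₀).symm⟩
  have hmem := h hp hX (m • z₀) hdiv
  rw [map_nsmul, ← Nat.cast_smul_eq_nsmul ℂ] at hmem
  have hm0 : (m : ℂ) ≠ 0 := by exact_mod_cast (show m ≠ 0 by omega)
  exact hz₀ ((Submodule.smul_mem_iff _ hm0).1 hmem)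

/-! ### (a') The shape of the hypothesis: "closed `≠ univ`" = "closed of codimension `≥ 1`" -/

section CodimOne

variable {n : ℕ} {X : SchemeOver ℂ}

/-- In the irreducible `X`, every point of a proper Zariski-closed `Z` has codimension `≥ 1`. -/
theorem one_le_coheight_of_mem_closed_ne_univ (hX : IsSmoothProjective n X) {Z : Set X.left}
    (hZ : IsClosed Z) (hZ' : Z ≠ Set.univ) {z : X.left} (hz : z ∈ Z) :
    ((1 : ℕ) : ℕ∞) ≤ Order.coheight z := by
  haveI := hX.geometricallyIrreducible
  haveI : IrreducibleSpace X.left := GeometricallyIrreducible.irreducibleSpace_of_subsingleton X.hom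
  rw [Nat.cast_one, Order.one_le_iff_ne_zero, ne_eq, Order.coheight_eq_zero]
  intro hmax
  apply hZ'
  have hzη : z ≤ genericPoint X.left :=
    Scheme.le_iff_specializes.2 ((genericPoint_spec X.left).specializes (Set.mem_univ z))
  have hηz : genericPoint X.left ≤ z := hmax hzη
  have hηZ : genericPoint X.left ∈ Z := (Scheme.le_iff_specializes.1 hηz).mem_closed hZ hz
  exact Set.eq_univ_of_forall fun x ↦
    ((genericPoint_spec X.left).specializes (Set.mem_univ x)).mem_closed hZ hηZ

/-- Conversely a closed set all of whose points have codimension `≥ 1` misses the generic point. -/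
theorem ne_univ_of_one_le_coheight (hX : IsSmoothProjective n X) {Z : Set X.left}
    (hZ : ∀ z ∈ Z, ((1 : ℕ) : ℕ∞) ≤ Order.coheight z) : Z ≠ Set.univ := by
  haveI := hX.geometricallyIrreducible
  haveI : IrreducibleSpace X.left := GeometricallyIrreducible.irreducibleSpace_of_subsingleton X.hom
  intro hu
  have h0 : Order.coheight (genericPoint X.left) = 0 :=
    Order.coheight_eq_zero.2 fun y _ ↦
      Scheme.le_iff_specializes.2 ((genericPoint_spec X.left).specializes (Set.mem_univ y))
  have h1 := hZ (genericPoint X.left) (hu ▸ Set.mem_univ _)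
  rw [h0, Nat.cast_one] at h1
  exact absurd h1 (by decide)

/-- C2 with the hypothesis' opens indexed exactly like `supportedClasses … 1`. -/
def GenericDivisibilityBoundedCodimOne : Prop :=
  ∀ ⦃p : ℕ⦄ ⦃X : SchemeOver ℂ⦄, 1 ≤ p → IsSmoothProjective (2 * p) X →
    ∀ z : singularCohomology ℤ ℤ (ComplexPoints X) (2 * p),
      (∀ m : ℕ, 1 ≤ m → ∃ Z : Set X.left, IsClosed Z ∧ (∀ x ∈ Z, ((1 : ℕ) : ℕ∞) ≤ Order.coheight x) ∧
        ∃ y : singularCohomology ℤ ℤ (complexPointsCompl X Z) (2 * p), m • y = restrictOff X Z (2 * p) z) →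
        singularCohomology.ringChange (Int.castRingHom ℂ) (ComplexPoints X) (2 * p) z ∈
          supportedClasses X (2 * p) 1

/-- The two indexings agree (geometric irreducibility inside `IsSmoothProjective`): no junk open. -/
theorem genericDivisibilityBounded_iff_codimOne :
    GenericDivisibilityBounded ↔ GenericDivisibilityBoundedCodimOne := by
  constructor
  · intro h p X hp hX z hz
    refine h hp hX z fun m hm ↦ ?_
    obtain ⟨Z, hZc, hZ1, y, hy⟩ := hz m hm
    exact ⟨Z, hZc, ne_univ_of_one_le_coheight hX hZ1, y, hy⟩
  · intro h p X hp hX z hz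
    refine h hp hX z fun m hm ↦ ?_
    obtain ⟨Z, hZc, hZne, y, hy⟩ := hz m hm
    exact ⟨Z, hZc, fun x hx ↦ one_le_coheight_of_mem_closed_ne_univ hX hZc hZne hx, y, hy⟩

end CodimOne

/-! ### (b) Natural strengthenings and their relation to the decl -/

/-- The ℓ-ADIC form (the route's kill criterion): divisibility by all powers of ONE prime already
forces coniveau `≥ 1`. Strictly stronger hypothesis-wise weaker; in print equally open. -/
def GenericDivisibilityBoundedPrimePower : Prop :=
  ∀ ⦃p : ℕ⦄ ⦃X : SchemeOver ℂ⦄, 1 ≤ p → IsSmoothProjective (2 * p) X →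
    ∀ z : singularCohomology ℤ ℤ (ComplexPoints X) (2 * p),
      (∃ ℓ : ℕ, ℓ.Prime ∧ ∀ r : ℕ, GenericallyDivisible X (2 * p) (ℓ ^ r) z) →
        singularCohomology.ringChange (Int.castRingHom ℂ) (ComplexPoints X) (2 * p) z ∈
          supportedClasses X (2 * p) 1

/-- The filed C2 is the WEAK form: if C2 fails, so does the ℓ-adic form (take `ℓ = 2`); a witness
"ℓ^r-divisible for all `r`, coniveau 0" kills `GenericDivisibilityBoundedPrimePower` but NOT the
decl, which needs divisibility by every integer (all primes at once, same class). -/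
theorem not_primePower_of_not (h : ¬ GenericDivisibilityBounded) :
    ¬ GenericDivisibilityBoundedPrimePower := fun hP ↦
  h fun _ _ hp hX z hz ↦ hP hp hX z ⟨2, Nat.prime_two, fun r ↦ hz (2 ^ r) Nat.one_le_two_pow⟩

/-- Monotonicity in the modulus: divisibility by `m * k` on an open gives divisibility by `m` on the
same open (so the hypothesis is equivalent to its restriction to any cofinal set of moduli, e.g.
factorials, and `∀ m` = `∀` prime powers `ℓ^r` FOR ALL `ℓ` via CRT on the f.g.-free lattice `I`
— the CRT step is paper-only here). -/
theorem genericallyDivisible_of_mul {X : SchemeOver ℂ} {k m c : ℕ}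
    {z : singularCohomology ℤ ℤ (ComplexPoints X) k}
    (h : GenericallyDivisible X k (m * c) z) : GenericallyDivisible X k m z := by
  obtain ⟨Z, hZc, hZne, y, hy⟩ := h
  exact ⟨Z, hZc, hZne, c • y, by rw [← mul_smul, hy]⟩

end Summit.HodgeConjecture.HodgeConjecture.Theorems.GenericDivisibilityBounded.Negative.LoadBearing

end
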